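import Mathlib
import HarnessLib
import HarnessLib.Audit
import Summits.AtomisticToContinuum.Statement
import Literature.MathematicalPhysics.KineticTheory.InfiniteChainDynamics
import Literature.MathematicalPhysics.KineticTheory.InfiniteChainInvariantStates
import Literature.MathematicalPhysics.KineticTheory.LangevinChainNESSHolds
import Summits.AtomisticToContinuum.FouriersLaw.Theorems.EmbeddedDrudeMourreNessUnique
import Summits.AtomisticToContinuum.FouriersLaw.Theorems.FourierGreenKuboFourierFiniteResponseOfUnique
import HarnessLib.Audit.Status.Attr

/-!
Route: NoHiddenChargesKubo

DORMANT since 2026-08-23T21:05:50Z (reconciler: no traction for 6.2 d (last activity item-evidence-added at 2026-08-17T14:38:07Z); parked, not closed — `ledger route dormant route-AtomisticToContinuum-NoHiddenChargesKubo --off` to react) — unstaffed, not closed; items shared with open routes are served there. `ledger route dormant <id> --off` reactivates.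

# Route NoHiddenChargesKubo — no hidden charges (local-charge classification + completeness) and a
classical Doyon hydrodynamic projection kill the ballistic channel; Green–Kubo-minus-the-atom then
gives FouriersLaw

X = X_mech ∧ X_slot ∧ X_fin, realising idea card no-hidden-charges-hydro-projection as a D-0027
§2.1-CONFORMING re-open of the retired route NoHiddenCharges (retired 2026-08-15T13:44Z
not-a-thesis: its assembly stopped at ZeroDrudeWeight). Notation: pinnedChain ω₂ lam β γ (ω₂, lam, β
> 0; γ is inert for the infinite chain), T > 0; a SYMMETRIC SET-UP is a DLR Gibbs state μ_T that is
shift- and momentum-reversal-invariant together with a μ_T-preserving infinite-volume dynamics φ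
commuting with the shift a.e. (the set-up of stmt-11029/11030/11036, verbatim); LocPoly = local
polynomial observables, LocObs = continuous polynomially bounded local observables (contains LocPoly
and the clipped currents F_M(j_x)), Cons Q ⇔ 𝒜Q = G∘shift − G with G ∈ LocPoly (a local conservation
law), Cov(f,g;t,x) = Cov_μ(f∘φ_t, g∘shift^x), K_f(t) = Σ_x Cov(f,f;t,x) the zero-wavenumber
autocorrelation, D_f = lim_τ τ⁻¹∫₀^τ K_f its Drude weight.
X_mech (the card's mechanism, four items): GibbsClustering (crux 2: every symmetric set-up has
summably space-clustering, time-continuous Cov for LocObs observables, locally uniformly in t —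
Gibbs-weighted locality) ∧ LocalChargeClassification (crux 3: energy is the only local polynomial
conservation law) ∧ ChargeCompleteness (crux 4, the NAMED HYPOTHESIS: Drude weights of LocObs
observables are Mazur-saturated by local polynomial charges — Doyon's completeness problem at
wavenumber 0) ∧ DrudeWeightExists (support: D_f exists and is ≥ 0, von Neumann/Bochner); by
momentum-reversal parity and telescoping these give, through the support item HydroBridge, the
shared node NoTruncatedDrude (stmt-11030: no ballistic channel, clipped form) for EVERY symmetric
set-up.
X_slot = GreenKuboOfNoDrude (crux 5, the shared import slot stmt-11029: Green–Kubo minus the atom at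
0). X_fin = NessUnique (0741) ∧ FiniteResponseOfUnique (0717) ∧ ThermodynamicLimit (0742), the
finite-N half shared with FourierGreenKubo / CurrentTiltQuench. Then FouriersLaw, by the PROVED
deciding theorem `closes` (Sketch.lean rc 0, axioms propext/Classical.choice/Quot.sound).
Lean: `GibbsClustering → DrudeWeightExists → ChargeCompleteness → LocalChargeClassification →
HydroBridge → GreenKuboOfNoDrude → NessUnique → FiniteResponseOfUnique → ThermodynamicLimit →
_root_.FouriersLaw`

## Assembly
`closes (hC : GibbsClustering) (hP : DrudeWeightExists) (hCC : ChargeCompleteness) (hK :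
LocalChargeClassification) (hB : HydroBridge) (hGK : GreenKuboOfNoDrude) (hNU : NessUnique) (hFR :
FiniteResponseOfUnique) (hTL : ThermodynamicLimit) : FouriersLaw` — PROVED sorry-free in the
planner's Sketch.lean / glue.lean (rc 0, ~35 lines, axioms propext, Classical.choice, Quot.sound).
Proof: (1) hbridge := hB hC hP hCC hK : NoTruncatedDrude, whose body after T is literally the
antecedent of GreenKuboOfNoDrude, giving the stmt-0703 body (a Gibbs state with a μ_T-preserving
HasGreenKubo dynamics) at every T > 0; (2) clause (i) of FouriersLawFor from the landed theorem
Literature.MathematicalPhysics.KineticTheory.HeatConduction.pinnedChain_exists_isSteadyState +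
NessUnique; κ T := greenKuboConductivity of the Classical.choose witnesses of ThermodynamicLimit (T
> 0, else 1), positive by HasGreenKubo.pos; for a steady-state family the D_N come from
FiniteResponseOfUnique and the ThermodynamicLimit spec gives D_N → κ T (same completion as
FourierGreenKubo / CurrentTiltQuench). The Assembly ITEM records the curried type of `closes`.

Rationale: WHY THIS LINE. Suzuki's equality (in tree:
Literature.Barriers.AtomisticToContinuum.Mazur.tendsto_inv_mul_integral_inner,
MazurBoundBallisticNarrow (1)–(3)) says the Drude weight of the current is ‖P j‖², P the projection
onto conserved vectors of the zero-wavenumber space ℋ₀; Doyon2022 (arXiv:2011.00611 §4, Thm 5.1)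
made this a theorem in INFINITE volume for quantum spin chains from a Lieb–Robinson bound and
clustering alone, flagged completeness/finite-dimensionality of the conserved subspace as "the most
important open problem" (§1 p.5) and pointed at Shiraishi2019's classification of local charges as
the first step; AmpelogiannisDoyon2026 §3.1 make exactly the 'Q = span of local charges' hypothesis
to get rigorous transport statements. We transplant both halves to the classical pinned chain with
an explicit dictionary (quasi-local C*-algebra ↦ LocObs on (ℝ²)^ℤ; Heisenberg flow ↦ Koopman flow of
the infinite Hamiltonian dynamics, ButtaMarchioro2016 Thm 2.1 / LanfordLebowitzLieb1977; KMS ↦ DLR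
Gibbs; Lieb–Robinson ↦ Gibbs-weighted covariance clustering (GibbsClustering); 𝒬₀ ↦ flow-invariant
vectors; support-size induction ↦ (range, weight) induction driven by {H₄,·}, KozlovTreshchev1990 /
Yamilov2006 as classical precedents) — areas imported: operator-algebraic hydrodynamics,
quantum-integrability classification, infinite-particle dynamics, ergodic theory (von
Neumann/Mazur1969/Suzuki1971, proved in tree). What is new relative to the retired NoHiddenCharges:
the mechanism is now stated for EVERY symmetric set-up and for the clipped-current observable class,
so that it discharges VERBATIM the antecedent of the existing import slot GreenKuboOfNoDrude
(stmt-11029) and the route literally decides FouriersLaw (closes proved); relative to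
CurrentTiltQuench (same node NoTruncatedDrude, same slot): that line trades classification +
completeness for odd-sector rigidity of space-time-invariant regular states (macro-ergodicity
flavour), this line needs no rigidity/regularity statement and instead isolates ONE decidable
algebraic input (classification, census-certified to (range,degree) = (3,8)/(4,6)/(2,10)) and ONE
sharply named analytic hypothesis (completeness) — two logically independent proofs of the
anti-ballistic node, sharing everything downstream. Negatives index (6 refuted statements, none in
FouriersLaw): nothing refuted is approached.

RANKED CRUXES. #2 GibbsClustering (crux) — GIBBS-WEIGHTED LOCALITY (card cruxes 2+3+5 at correlation
level; the classical stand-in for Doyon2022 §4 Def 4.3–4.4/4.8): for pinnedChain (ω₂, lam, β > 0), T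
> 0 and EVERY symmetric set-up (μ, D), for all f, g ∈ LocObs: (i) (f∘φ_t)·(g∘shift^x) ∈ L¹(μ) for
all t, x; (ii) for every t₀ a summable m : ℤ → ℝ dominates |Cov(f,g;t,x)| for all t ∈ [0,t₀], x ∈ ℤ;
(iii) each t ↦ Cov(f,g;t,x) is continuous; (iv) t ↦ Σ_x Cov(f,g;t,x) is continuous. Static part (t =
0): exponential clustering of the 1-D Gibbs field (transfer operator e^(−U/2T)e^(−V/T)e^(−U/2T),
Hilbert–Schmidt); dynamic part: finite-time quasi-locality of f∘φ_t in L²(μ_T) (an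
L²-Lieb–Robinson-type bound with Gaussian-tail corrections). [difficulty: XL] (why it might fail:
Only almost-linear light cones |i−j| > t·log^α t are proved pointwise for quartic lattices
(ButtaMarchioro2016 Thm 2.2: finite speed 'not clear … for this type of observables'); x-summability
of Cov(f∘φ_t, g_x) at fixed t is unproved; ∀ over DLR states leans on 1-D temperedness/uniqueness.)
[ButtaMarchioro2016, ButtaEtAl2007, Doyon2022, RazSims2009, LanfordLebowitzLieb1977,
MarchioroPellegrinottiPulvirenti1978, BenfattoEtAl1980]
#3 LocalChargeClassification (crux) — NO HIDDEN LOCAL CHARGES (card item 1; classical Shiraishi-type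
classification): for pinnedChain with ω₂, lam, β > 0, every local polynomial density f ∈ LocPoly
satisfying a local continuity equation 𝒜f = G∘shift − G with G ∈ LocPoly (𝒜 = liouvilleZ, the
in-tree Liouville operator) is c·e₀ + d + (G′∘shift − G′) with e₀ = p₀²/2 + U(q₀) + V(q₁ − q₀),
constants c, d and G′ ∈ LocPoly — ENERGY IS THE ONLY LOCAL POLYNOMIAL CONSERVATION LAW (e₀ itself:
𝒜e₀ = G∘shift − G with G = p₀V′(q₀ − q₋₁)). Proof plan: (range, weight)-graded induction (q:1, p:2;
{H₄,·} raises weight by 1, widens support by ≤ 1): the top-weight part of f is a charge of the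
scale-free quartic anchor, absent above weight 4 by over-determination of the leading part
(Shiraishi2019 support induction transplanted; finite-N precedent KozlovTreshchev1990; all-orders
counterpart Yamilov2006), then descent in weight. Certified census (closed data card
local-charge-census-normalisation-section): kernel = span{1, e₀} up to (range,degree) = (3,8),
(4,6), (2,10), anchor empty above weight 4 to W = 12. [difficulty: L] (why it might fail: An
isolated higher conservation law at LARGE range (integrable lattices carry charges of every range;
the census bounds range and degree together) — low prior after (3,8)/(4,6)/(2,10), but the all-range
induction must genuinely use the quartic top-weight over-determination, never done classically.)
[Shiraishi2019, doi:10.1103/physrevb.109.035123, KozlovTreshchev1990, Yamilov2006,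
doi:10.1088/0305-4470/28/17/013, Doyon2022]
#4 ChargeCompleteness (crux) — COMPLETENESS OF LOCAL CHARGES AT WAVENUMBER 0 — the NAMED HYPOTHESIS
of the line (Doyon's 'most important open problem', classical pinned chain, elementary
Mazur-saturation form): for every symmetric set-up with the GibbsClustering clauses and every f ∈
LocObs, for every ε > 0 there is a local polynomial conserved density Q (Cons Q, ‖Q‖₀² = Σ_x
Cov(Q,Q;0,x) > 0) with τ⁻¹∫₀^τ K_f eventually ≤ ⟨f,Q⟩₀²/‖Q‖₀² + ε (⟨f,Q⟩₀ = Σ_x Cov(f,Q;0,x); a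
finite combination of local charges is again one, so a single Q suffices). Equivalent, given
DrudeWeightExists, to: the flow-invariant subspace of ℋ₀ is the closure of the images of local
polynomial conserved densities (AmpelogiannisDoyon2026 §3.1 assume exactly this). With
LocalChargeClassification it reads 𝒬₀ = ℝ·[e₀]; sanity: for f = e₀ the bound is saturated. Its
NEGATION — a pseudolocal (ℋ₀-limit of local observables) momentum-odd invariant vector overlapping j
— is the precise shape of a ballistic counterexample to FouriersLaw. [deps: GibbsClustering,
DrudeWeightExists] [difficulty: open-problem] (why it might fail: It is a real-time ergodicity
statement for a deterministic anharmonic lattice — no theorem of this kind exists for any such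
model; long-lived breathers / KAM-like structures (low T, strong pinning) could leave a pseudolocal
invariant vector of ℋ₀ outside the closure of local charges.) [Doyon2022, AmpelogiannisDoyon2026,
doi:10.1007/s00220-023-04849-9, doi:10.1007/s00023-023-01304-2, Mazur1969, Suzuki1971]
#5 GreenKuboOfNoDrude (crux) — IMPORT SLOT, shared verbatim with route CurrentTiltQuench
(stmt-AtomisticToContinuum-11029, 'Green–Kubo minus the ballistic atom'): for all parameters > 0 and
T > 0, IF every symmetric set-up has vanishing truncated Drude weights in the NoTruncatedDrude form,
THEN some Gibbs state carries a μ_T-preserving dynamics with HasGreenKubo (C_T absolutely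
convergent, in L¹(0,∞), κ_GK > 0) — the body of crux FourierGreenKubo (stmt-0703) at T. NOT this
route's mechanism: the residual is the REGULAR part of the current spectral measure near 0 (cards
herglotz-current-spectral-measure / embedded-drude-eigenvalue-mourre-fgr; any decay proof of 0703
closes it a fortiori). [deps: NoTruncatedDrude, SymmetricSetup] [difficulty: open-problem] (why it
might fail: = stmt-0703 minus the atom at 0: zero Cesàro mean gives neither C_T ∈ L¹ (kinetic FPU-β
tail t^(-3/5) unpinned, LukkarinenSpohn2008; breather tails at low T) nor κ_GK > 0; summable C_T
needs unprinted quartic-V propagation bounds.) [BonettoLebowitzReyBellet2000, Bernardin2014,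
LukkarinenSpohn2008, AokiLukkarinenSpohn2006, Spohn2014, Mazur1969]
#9 DrudeWeightExists (support) — CLASSICAL HYDRODYNAMIC PROJECTION AT κ = 0, existence half
(Doyon2022 Thm 5.1 transplanted; von Neumann / Bochner): for every symmetric set-up with the
GibbsClustering clauses and every f ∈ LocObs the Cesàro mean τ⁻¹∫₀^τ K_f(t) dt converges to some D_f
≥ 0. Proof route: K_f is continuous (clause iv) and positive-definite in t (Fejér: L⁻¹Var(Σ_(|x|<L)
Σ_k c_k f∘shift^x∘φ_(t_k)) ≥ 0, shift-invariance + stationarity + dominated clustering), hence the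
Fourier transform of a finite positive measure σ_f and the Cesàro means tend to σ_f({0}) ≥ 0; or
GNS/Kolmogorov dilation + in-tree Mazur.tendsto_inv_mul_integral_inner. [difficulty: M] [Doyon2022,
Mazur1969, Suzuki1971, decl
Literature.Barriers.AtomisticToContinuum.Mazur.tendsto_inv_mul_integral_inner]
#9 NoTruncatedDrude (support) — THE SHARED NODE (verbatim stmt-AtomisticToContinuum-11030 of route
CurrentTiltQuench; no ballistic channel, clipped form): for every symmetric set-up of pinnedChain
(ω₂, lam, β > 0), T > 0, every M, η > 0: ∃τ₀ ∀τ≥τ₀ ∃L₀ ∀L≥L₀ |τ⁻¹∫₀^τ Cov_μ(F_M(j_0)∘φ_t, Σ_(|x|≤L)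
F_M(j_x)) dt| ≤ η. Closed HERE by HydroBridge from the four mechanism items (second, logically
independent proof path besides CurrentTiltQuench's BridgeGlue); it is literally the antecedent of
GreenKuboOfNoDrude after T. [difficulty: L] [Mazur1969, Suzuki1971, Doyon2022]
#9 SymmetricSetup (support) — DE-VACUIFIER (verbatim stmt-AtomisticToContinuum-11036): for ω₂, lam,
β > 0 and T > 0 there are a shift- and momentum-reversal-invariant DLR Gibbs state μ_T (1-D transfer
operator, Hilbert–Schmidt: unique, hence symmetric) and an InfiniteChainDynamics preserving μ_T
whose flow commutes with the shift μ_T-a.e. (LanfordLebowitzLieb1977 Thm 3 a.e. existence +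
uniqueness class; ButtaMarchioro2016 Thm 2.1 for quartic U and V). Makes the ∀-set-up items
non-vacuous. [difficulty: L] [LanfordLebowitzLieb1977, ButtaMarchioro2016, ButtaEtAl2007,
Georgii2011]
#9 NessUnique (support) — verbatim stmt-AtomisticToContinuum-0741 (shared by the FouriersLaw
routes): uniqueness of the weak steady state (IsSteadyState class) of pinnedChain for all N, T_L,
T_R > 0 (CuneoEckmannHairerReyBellet2018 Thm 2.13 + Echeverría/well-posed martingale problem
identification); with the landed pinnedChain_exists_isSteadyState it gives clause (i) of
FouriersLawFor. [difficulty: L] [CuneoEckmannHairerReyBellet2018, ReyBellet2003]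
#9 FiniteResponseOfUnique (support) — verbatim stmt-AtomisticToContinuum-0717: under weak-NESS
uniqueness the finite-N linear-response limit D_N(T) = lim_(δ→0,δ≠0)
totalCurrent(μ_(N,T+δ/2,T−δ/2))/δ exists (HairerMajda2009 framework; ReyBellet2003 Rem 4.4
finite-volume Kubo formula). [difficulty: L] [HairerMajda2009, ReyBellet2003]
#9 ThermodynamicLimit (support) — verbatim stmt-AtomisticToContinuum-0742 (crux 3 of
FourierGreenKubo, support here as in CurrentTiltQuench/KineticCorner): under weak-NESS uniqueness,
if some Gibbs state with a μ_T-preserving Green–Kubo dynamics exists at T, then there is such a pair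
(μ_T, D) with D_N → greenKuboConductivity D μ_T T for every steady-state family and every sequence
of finite-volume response coefficients. [difficulty: open-problem] [BonettoLebowitzReyBellet2000,
Dhar2008, ReyBellet2003]
#9 HydroBridge (support) — THE BRIDGE (elementary; ≈ 400–800 Lean lines, no new mathematics):
GibbsClustering → DrudeWeightExists → ChargeCompleteness → LocalChargeClassification →
NoTruncatedDrude. Proof: fix a symmetric set-up, M, F = clip_M, η; f := F∘(bondCurrentZ · 0) ∈
LocObs (continuous, bounded, box {0,1}). DrudeWeightExists: τ⁻¹∫₀^τ K_f → D_f ≥ 0.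
ChargeCompleteness at (f, ε): a conserved Q ∈ LocPoly with ‖Q‖₀² > 0 and Cesàro means eventually ≤
⟨f,Q⟩₀²/‖Q‖₀² + ε. LocalChargeClassification: Q = c·e₀ + d + (G∘shift − G). Then ⟨f,Q⟩₀ = 0: Cov(f,
e₀∘shift^x) = 0 because μ.map(p ↦ −p) = μ, f odd, e₀ even (flow 0 = id μ-a.e.); Cov(f, const) = 0;
the telescopic part is Σ_x (a_(x+1) − a_x) = 0 for the summable a_x = Cov(f,G;0,x) (clause ii).
Hence D_f ≤ ε for all ε, so D_f = 0. Finally the 11030 expression equals τ⁻¹∫₀^τ Σ_(|x|≤L)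
Cov(f,f;t,x) dt (F(bondCurrentZ σ x) = f(shift^x σ); integral_finset_sum by clause i), and by clause
(ii) on [0,τ] it is within Σ_(|x|>L) m x of τ⁻¹∫₀^τ K_f: choose τ₀ ≥ 1 with |τ⁻¹∫₀^τ K_f| ≤ η/2
beyond it, then L₀ with the tail ≤ η/2. [difficulty: M] [Mazur1969, Suzuki1971, Doyon2022, decl
Literature.Barriers.AtomisticToContinuum.Mazur.starProjection_eq_zero_of_reversing]

TWO-LAYER PLAN. Foreseen glued splits (k ≤ 3, depth 1; nothing filed now): GibbsClustering ⇐
StaticClustering (exponential clustering of the 1-D Gibbs field for LocObs, transfer-operator gap) →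
GibbsLightCone (an L²(μ_T) finite-time quasi-locality bound for f∘φ_t with summable tails) →
GibbsClustering; LocalChargeClassification ⇐ AnchorNoHighCharges (the scale-free quartic anchor has
no charges of weight ≠ 0, 4) → DescentToFullChain → LocalChargeClassification (the closed data
card's items 3–4); ChargeCompleteness is not decomposed (it is the named hypothesis; its negation is
staffed as a refutation target).

KILL CRITERIA. (a) ¬LocalChargeClassification: a local polynomial conserved density outside span{e₀,
1} + telescopic. If momentum-ODD with Σ_x Cov(j_0, Q_x) ≠ 0 it refutes crux FourierGreenKubo
(stmt-0703) via Mazur1969_inequality.tendsto_integral_atTop and morally FouriersLaw: close this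
route refuted:LocalChargeClassification and file ¬0703. If EVEN / orthogonal to j: restate the
classification with the enlarged list (route survives; the bridge only needs ⟨F_M(j_0), Q⟩₀ = 0 for
every conserved Q). (b) ¬ChargeCompleteness witnessed by a pseudolocal odd invariant vector
overlapping j: as (a), substantive. (c) ¬GibbsClustering (Cov(f∘φ_t, g_x) provably not summable in x
at a fixed t for some LocObs pair, or failing for an exotic shift-invariant DLR state): the ℋ₀
framework is dead for unbounded lattices in this form — pivot to a tempered/regular sub-class of
set-ups (restate with a regularity clause as CurrentTiltQuench's BoundedOddRigidity does) or close
refuted:GibbsClustering. (d) A refutation of GreenKuboOfNoDrude or ThermodynamicLimit kills every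
Green–Kubo-completed line at once (FourierGreenKubo, CurrentTiltQuench, KineticCorner, this one).
Mooted (superseded) if stmt-0703 is proved directly by decay.

NOT DECOMPOSED YET. The construction of ℋ₀ (GNS/Kolmogorov dilation) behind DrudeWeightExists; the
static-vs-dynamic split of GibbsClustering (Two-layer plan); the anchor-first induction of
LocalChargeClassification; any Euler-scale (κ ≠ 0) projection, a.e.-ray ergodicity or
diffusive-scale statement (Doyon JSP 2022) — deliberately out of scope; the regular part of the
current spectral measure (inside the import slot, owned by FourierGreenKubo / the Herglotz and
Mourre cards); T-dependence of κ.

CHEAPEST FALSIFIER. Run the classification as a computation: the kernel of the charge map on local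
polynomial densities of bounded (range, weighted degree) modulo Image(shift − 1) — ALREADY RUN by
the closed data card local-charge-census-normalisation-section (exact modular linear algebra,
calibrated on the harmonic chain which returns its extra charges): kernel = span{1, e₀} for
pinnedChain(1,1,1) up to (r,W) = (3,8), (4,6), (2,10), at the dimer-integrable parameters, and the
scale-free anchor is empty above weight 4 to W = 12. Next cheapest: push to (5,8)/(4,10) on the farm
(kit, minutes); any non-trivial kernel vector kills crux 3 and, if odd and overlapping j, crux 0703
of FourierGreenKubo by the in-tree Mazur inequality. For crux 2 the cheapest probe is the harmonic
member lam = β = 0, where Cov(f∘φ_t, g_x) is explicit (Bessel-type kernels, exponentially small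
outside |x| ≲ ct): summable at each fixed t — consistent (the harmonic chain fails the line only at
crux 3, as it must).

NUMBERS. Census (closed data card, exact): pinnedChain(ω₂,lam,β) = (1,1,1): (r,W) ∈
{(2,6),(2,8),(2,10),(3,6),(3,8),(4,6)} energy only ((3,8): 568 unknowns, 2038 equations);
dimer-integrable point (2/3,1,7/8): (2,8),(2,10),(3,8),(4,6) energy only; anchor W = 8,10,12 at r =
2,3: no charge. Harmonic calibration: 3 resp. 5 charges at (2,4),(3,4). Light cone in print: |i−j| >
t·log^α t (ButtaMarchioro2016 Thm 2.2), not ct.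

DEFINITION REQUESTS. None at open: LocPoly / LocObs / Cons / Cov are inlined with `let` over in-tree
boxRestrictAt, liouvilleZ, shift, InfiniteChainDynamics.flow; a Literature definition
(IsLocalPolynomial, IsLocalObservable, IsLocalConservationLaw, hydroCovariance under
Literature/MathematicalPhysics/KineticTheory) would shorten every signature 1:1 and can be requested
once a prover asks.

Novelty: Searches (2026-08-15, this planner; lit searchd was intermittently unavailable, rc 75, retried):
inherited and re-read the card's and the gen-1 route's search log (crossref 'Shiraishi absence of
local conserved quantities' — quantum only; 'nonexistence additional first integrals FPU lattice' —
finite-N differential Galois only; 'Doyon hydrodynamic projections' — C*-framework, classical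
unbounded case outside the stated theorems; 'Lieb-Robinson classical anharmonic' — bounds exist, no
transport use; `lit read` arXiv:2011.00611 pp.5,12–14,18; arXiv:1602.01294 pp.3–5;
arXiv:math-ph/0607023 p.4), the two refuter novelty audits on the card (new-combination, concurring;
nearest prior named below), `lean search` of every constant in the statements, the negatives index
(6 entries, none FouriersLaw), and the six open FouriersLaw route files (FourierGreenKubo,
CurrentTiltQuench, OddSectorIrreversibility, BondHeatUncertainty, KineticCorner, PorousMediumCorner)
for overlap: only CurrentTiltQuench reaches the node NoTruncatedDrude, by a different engine.
Nearest prior art found: Doyon2022 (doi:10.1007/s00220-022-04310-3, arXiv:2011.00611: hydrodynamic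
projections, quantum spin chains; §1 names completeness as open and Shiraishi as first step);
doi:10.1007/s10955-021-02863-6 (Doyon JSP 2022 §2: framework 'classical or quantum' at the formal
level); AmpelogiannisDoyon2026 §3.1 (assume completeness, derive rigorous transport); Shiraishi2019
/ doi:10.1103/physrevb.109.035123 (quantum charge c  [refs: 10.1007/s00220-022-04310-3, 10.1007/s10955-021-02863-6, 10.1103/physrevb.109.035123, 2011.00611, 1602.01294, math-ph/0607023, doi:10.1007/s00220-022-04310-3, doi:10.1007/s10955-021-02863-6, doi:10.1103/physrevb.109.035123, Doyon2022, AmpelogiannisDoyon2026, Shiraishi2019, KozlovTreshchev1990, Yamilov2006, ButtaMarchioro2016]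

Barriers (technique_class: charge-classification hydrodynamic-projection green-kubo): - technique_class: charge-classification hydrodynamic-projection green-kubo
- Literature.Barriers.AtomisticToContinuum.Mazur1969_inequality: NOT evaded — ATTACKED HEAD-ON. The
barrier says a conserved Q of the infinite pinned chain overlapping j makes ∫₀^τ C_T grow linearly
(Mazur1969_inequality.tendsto_integral_atTop), so every Green–Kubo argument must exclude such Q;
crux LocalChargeClassification IS that exclusion for local polynomial densities, ChargeCompleteness
names what remains (pseudolocal charges), the bridge USES the barrier's mathematics (Suzuki's
equality / the in-tree Mazur file) instead of an argument blind to conservation laws, and a found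
odd charge overlapping j is the recorded kill criterion (⇒ ¬stmt-0703 via this very theorem). The
barrier's evasion (i) (pinning removes momentum conservation) is why ⟨JP⟩-type overlaps are absent
here.
- Literature.Barriers.AtomisticToContinuum.MazurBoundBallisticNarrow: consistent and USED: conjunct
(1) (Suzuki: Drude weight = ‖P j‖²), (2) (silence ⇔ j ⊥ conserved vectors) and (3) (parity: a
reversing isometry fixing the conserved vectors forces P j = 0) are the abstract skeleton of
DrudeWeightExists + HydroBridge; the barrier's scope caveat 'absence of further local conserved
quantities overlapping J is UNPROVED' for pinnedChain is exactly crux LocalChargeClassification, and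
ChargeCompleteness names what remains (pseudolocal charges); a found charge is the recorded kill
criterion.
- Literature.Barriers.AtomisticToContinuu

History (route lifecycle, newest last):
- 2026-08-23T21:05:50Z · DORMANT — reconciler: no traction for 6.2 d (last activity item-evidence-added at 2026-08-17T14:38:07Z); parked, not closed — `ledger route dormant route-AtomisticToConti (operator:999:2584177)

sub-problem: FouriersLaw · status: dormant · opened planner-plancard-AtomisticToContinuum-Fourier-bada3c5d-g2-0 2026-08-15T18:46:01Z · rev 3 · ledger route-AtomisticToContinuum-NoHiddenChargesKubo
GENERATED by the gate from the ledger (D-0016/17). Provers cite these decls: `theorem foo : Summit.AtomisticToContinuum.FouriersLaw.Theses.NoHiddenChargesKubo.<Decl> := …` in Summits/AtomisticToContinuum/FouriersLaw/Theorems/<Name>.lean.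
-/

namespace Summit.AtomisticToContinuum.FouriersLaw.Theses.NoHiddenChargesKubo

open scoped BigOperators Topology Manifold Classical MeasureTheory ProbabilityTheory Matrix InnerProductSpace ComplexConjugate ContinuousMap
open Filter Set Function TopologicalSpace MeasureTheory

attribute [summit_statement] _root_.FouriersLaw

/-- item stmt-AtomisticToContinuum-11913 · crux · rank 2 · open · by planner
why it might fail: Only almost-linear light cones |i−j| > t·log^α t are proved pointwise for quartic lattices (ButtaMarchioro2016 Thm 2.2: finite speed 'not clear … for this type of observables'); x-summability of Cov(f∘φ_t, g_x) at fixed t is unproved; ∀ over DLR states leans on 1-D temperedness/uniqueness.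
sources: ButtaMarchioro2016, ButtaEtAl2007, Doyon2022, RazSims2009, LanfordLebowitzLieb1977, MarchioroPellegrinottiPulvirenti1978
[crux] GIBBS-WEIGHTED LOCALITY (card cruxes 2+3+5 at correlation level; the classical stand-in for
Doyon2022 §4 Def 4.3–4.4/4.8): for pinnedChain (ω₂, lam, β > 0), T > 0 and EVERY symmetric set-up
(μ, D), for all f, g ∈ LocObs: (i) (f∘φ_t)·(g∘shift^x) ∈ L¹(μ) for all t, x; (ii) for every t₀ a
summable m : ℤ → ℝ dominates |Cov(f,g;t,x)| for all t ∈ [0,t₀], x ∈ ℤ; (iii) each t ↦ Cov(f,g;t,x)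
is continuous; (iv) t ↦ Σ_x Cov(f,g;t,x) is continuous. Static part (t = 0): exponential clustering
of the 1-D Gibbs field (transfer operator e^(−U/2T)e^(−V/T)e^(−U/2T), Hilbert–Schmidt); dynamic
part: finite-time quasi-locality of f∘φ_t in L²(μ_T) (an L²-Lieb–Robinson-type bound with
Gaussian-tail corrections). [difficulty: XL] -/
@[route_item "route-AtomisticToContinuum-NoHiddenChargesKubo", crux]
def GibbsClustering : Prop :=
  ∀ ω₂ lam β γ : ℝ, 0 < ω₂ → 0 < lam → 0 < β → ∀ T : ℝ, 0 < T → ∀ μ : MeasureTheory.Measure Literature.MathematicalPhysics.KineticTheory.HeatConduction.ChainConfig, (Literature.MathematicalPhysics.KineticTheory.HeatConduction.pinnedChain ω₂ lam β γ).IsChainGibbsMeasure T μ → Literature.MathematicalPhysics.KineticTheory.HeatConduction.IsShiftInvariant μ → μ.map (fun σ : Literature.MathematicalPhysics.KineticTheory.HeatConduction.ChainConfig => fun x : ℤ => ((σ x).1, -(σ x).2)) = μ → ∀ D : Literature.MathematicalPhysics.KineticTheory.HeatConduction.InfiniteChainDynamics (Literature.MathematicalPhysics.KineticTheory.HeatConduction.pinnedChain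 ω₂ lam β γ), D.PreservesMeasure μ → (∀ t : ℝ, ∀ᵐ σ ∂μ, D.flow t (Literature.MathematicalPhysics.KineticTheory.HeatConduction.shift σ) = Literature.MathematicalPhysics.KineticTheory.HeatConduction.shift (D.flow t σ)) → let LocObs : (Literature.MathematicalPhysics.KineticTheory.HeatConduction.ChainConfig → ℝ) → Prop := fun f => ∃ (a : ℤ) (n : ℕ) (g : (Fin (n + 1) → ℝ × ℝ) → ℝ), Continuous g ∧ (∃ (C : ℝ) (k : ℕ), ∀ v, |g v| ≤ C * (1 + ‖v‖) ^ k) ∧ ∀ σ, f σ = g (Literature.MathematicalPhysics.KineticTheory.HeatConduction.boxRestrictAt a n σ); let Cov : (Literature.MathematicalPhysics.KineticTheory.HeatConduction.ChainConfig → ℝ) → (Literature.MathematicalPhysics.KineticTheory.HeatConduction.ChainConfig → ℝ) → ℝ → ℤ → ℝ := fun f g t x => MeasureTheory.integral μ (fun σ => f (D.flow t σ) * g (fun y => σ (y + x))) - MeasureTheory.integral μ (fun σ => f (D.flow t σ)) * MeasureTheory.integral μ (fun σ => g (fun y => σ (y + x))); ∀ f g : Literature.MathematicalPhysics.KineticTheory.HeatConduction.ChainConfig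 → ℝ, LocObs f → LocObs g → (∀ (t : ℝ) (x : ℤ), MeasureTheory.Integrable (fun σ => f (D.flow t σ) * g (fun y => σ (y + x))) μ) ∧ (∀ t₀ : ℝ, ∃ m : ℤ → ℝ, Summable m ∧ ∀ t ∈ Set.Icc (0 : ℝ) t₀, ∀ x : ℤ, |Cov f g t x| ≤ m x) ∧ (∀ x : ℤ, Continuous (fun t : ℝ => Cov f g t x)) ∧ Continuous (fun t : ℝ => ∑' x : ℤ, Cov f g t x)

/-- item stmt-AtomisticToContinuum-11914 · crux · rank 3 · open · by planner
why it might fail: An isolated higher conservation law at LARGE range (integrable lattices carry charges of every range; the census bounds range and degree together) — low prior after (3,8)/(4,6)/(2,10), but the all-range induction must genuinely use the quartic top-weight over-determination, never done classically.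
sources: Shiraishi2019, doi:10.1103/physrevb.109.035123, KozlovTreshchev1990, Yamilov2006, doi:10.1088/0305-4470/28/17/013, Doyon2022
[crux] NO HIDDEN LOCAL CHARGES (card item 1; classical Shiraishi-type classification): for
pinnedChain with ω₂, lam, β > 0, every local polynomial density f ∈ LocPoly satisfying a local
continuity equation 𝒜f = G∘shift − G with G ∈ LocPoly (𝒜 = liouvilleZ, the in-tree Liouville
operator) is c·e₀ + d + (G′∘shift − G′) with e₀ = p₀²/2 + U(q₀) + V(q₁ − q₀), constants c, d and G′
∈ LocPoly — ENERGY IS THE ONLY LOCAL POLYNOMIAL CONSERVATION LAW (e₀ itself: 𝒜e₀ = G∘shift − G with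
G = p₀V′(q₀ − q₋₁)). Proof plan: (range, weight)-graded induction (q:1, p:2; {H₄,·} raises weight by
1, widens support by ≤ 1): the top-weight part of f is a charge of the scale-free quartic anchor,
absent above weight 4 by over-determination of the leading part (Shiraishi2019 support induction
transplanted; finite-N precedent KozlovTreshchev1990; all-orders counterpart Yamilov2006), then
descent in weight. Certified census (closed data card local-charge-census-normalisation-section):
kernel = span{1, e₀} up to (range,degree) = (3,8), (4,6), (2,10), anchor empty above weight 4 to W =
12. [difficulty: L] -/
@[route_item "route-AtomisticToContinuum-NoHiddenChargesKubo", crux]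
def LocalChargeClassification : Prop :=
  ∀ ω₂ lam β γ : ℝ, 0 < ω₂ → 0 < lam → 0 < β → let LocPoly : (Literature.MathematicalPhysics.KineticTheory.HeatConduction.ChainConfig → ℝ) → Prop := fun f => ∃ (a : ℤ) (n : ℕ) (w : MvPolynomial (Fin (n + 1) × Bool) ℝ), ∀ σ, f σ = MvPolynomial.eval (fun v : Fin (n + 1) × Bool => if v.2 then (Literature.MathematicalPhysics.KineticTheory.HeatConduction.boxRestrictAt a n σ v.1).2 else (Literature.MathematicalPhysics.KineticTheory.HeatConduction.boxRestrictAt a n σ v.1).1) w; let Cons : (Literature.MathematicalPhysics.KineticTheory.HeatConduction.ChainConfig → ℝ) → Prop := fun Q => ∃ G : Literature.MathematicalPhysics.KineticTheory.HeatConduction.ChainConfig → ℝ, LocPoly G ∧ ∀ σ, Literature.MathematicalPhysics.KineticTheory.HeatConduction.liouvilleZ (Literature.MathematicalPhysics.KineticTheory.HeatConduction.pinnedChain ω₂ lam β γ) Q σ = G (Literature.MathematicalPhysics.KineticTheory.HeatConduction.shift σ) - G σ; ∀ f : Literature.MathematicalPhysics.KineticTheory.HeatConduction.ChainConfig → ℝ,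 LocPoly f → Cons f → ∃ (c d : ℝ) (G : Literature.MathematicalPhysics.KineticTheory.HeatConduction.ChainConfig → ℝ), LocPoly G ∧ ∀ σ, f σ = c * ((σ 0).2 ^ 2 / 2 + (Literature.MathematicalPhysics.KineticTheory.HeatConduction.pinnedChain ω₂ lam β γ).U (σ 0).1 + (Literature.MathematicalPhysics.KineticTheory.HeatConduction.pinnedChain ω₂ lam β γ).V ((σ 1).1 - (σ 0).1)) + d + (G (Literature.MathematicalPhysics.KineticTheory.HeatConduction.shift σ) - G σ)

/-- item stmt-AtomisticToContinuum-11915 · crux · rank 4 · open · by planner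
why it might fail: It is a real-time ergodicity statement for a deterministic anharmonic lattice — no theorem of this kind exists for any such model; long-lived breathers / KAM-like structures (low T, strong pinning) could leave a pseudolocal invariant vector of ℋ₀ outside the closure of local charges.
sources: Doyon2022, AmpelogiannisDoyon2026, doi:10.1007/s00220-023-04849-9, doi:10.1007/s00023-023-01304-2, Mazur1969, Suzuki1971
[crux] COMPLETENESS OF LOCAL CHARGES AT WAVENUMBER 0 — the NAMED HYPOTHESIS of the line (Doyon's
'most important open problem', classical pinned chain, elementary Mazur-saturation form): for every
symmetric set-up with the GibbsClustering clauses and every f ∈ LocObs, for every ε > 0 there is a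
local polynomial conserved density Q (Cons Q, ‖Q‖₀² = Σ_x Cov(Q,Q;0,x) > 0) with τ⁻¹∫₀^τ K_f
eventually ≤ ⟨f,Q⟩₀²/‖Q‖₀² + ε (⟨f,Q⟩₀ = Σ_x Cov(f,Q;0,x); a finite combination of local charges is
again one, so a single Q suffices). Equivalent, given DrudeWeightExists, to: the flow-invariant
subspace of ℋ₀ is the closure of the images of local polynomial conserved densities
(AmpelogiannisDoyon2026 §3.1 assume exactly this). With LocalChargeClassification it reads 𝒬₀ =
ℝ·[e₀]; sanity: for f = e₀ the bound is saturated. Its NEGATION — a pseudolocal (ℋ₀-limit of local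
observables) momentum-odd invariant vector overlapping j — is the precise shape of a ballistic
counterexample to FouriersLaw. [deps: GibbsClustering, DrudeWeightExists] [difficulty: open-problem] -/
@[route_item "route-AtomisticToContinuum-NoHiddenChargesKubo", crux]
def ChargeCompleteness : Prop :=
  ∀ ω₂ lam β γ : ℝ, 0 < ω₂ → 0 < lam → 0 < β → ∀ T : ℝ, 0 < T → ∀ μ : MeasureTheory.Measure Literature.MathematicalPhysics.KineticTheory.HeatConduction.ChainConfig, (Literature.MathematicalPhysics.KineticTheory.HeatConduction.pinnedChain ω₂ lam β γ).IsChainGibbsMeasure T μ → Literature.MathematicalPhysics.KineticTheory.HeatConduction.IsShiftInvariant μ → μ.map (fun σ : Literature.MathematicalPhysics.KineticTheory.HeatConduction.ChainConfig => fun x : ℤ => ((σ x).1, -(σ x).2)) = μ → ∀ D : Literature.MathematicalPhysics.KineticTheory.HeatConduction.InfiniteChainDynamics (Literature.MathematicalPhysics.KineticTheory.HeatConduction.pinnedChain ω₂ lam β γ), D.PreservesMeasure μ → (∀ t : ℝ, ∀ᵐ σ ∂μ, D.flow t (Literature.MathematicalPhysics.KineticTheory.HeatConduction.shift σ) = Literature.MathematicalPhysics.KineticTheory.HeatConduction.shift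 (D.flow t σ)) → let LocPoly : (Literature.MathematicalPhysics.KineticTheory.HeatConduction.ChainConfig → ℝ) → Prop := fun f => ∃ (a : ℤ) (n : ℕ) (w : MvPolynomial (Fin (n + 1) × Bool) ℝ), ∀ σ, f σ = MvPolynomial.eval (fun v : Fin (n + 1) × Bool => if v.2 then (Literature.MathematicalPhysics.KineticTheory.HeatConduction.boxRestrictAt a n σ v.1).2 else (Literature.MathematicalPhysics.KineticTheory.HeatConduction.boxRestrictAt a n σ v.1).1) w; let LocObs : (Literature.MathematicalPhysics.KineticTheory.HeatConduction.ChainConfig → ℝ) → Prop := fun f => ∃ (a : ℤ) (n : ℕ) (g : (Fin (n + 1) → ℝ × ℝ) → ℝ), Continuous g ∧ (∃ (C : ℝ) (k : ℕ), ∀ v, |g v| ≤ C * (1 + ‖v‖) ^ k) ∧ ∀ σ, f σ = g (Literature.MathematicalPhysics.KineticTheory.HeatConduction.boxRestrictAt a n σ); let Cons : (Literature.MathematicalPhysics.KineticTheory.HeatConduction.ChainConfig → ℝ) → Prop := fun Q => ∃ G : Literature.MathematicalPhysics.KineticTheory.HeatConduction.ChainConfig → ℝ, LocPoly G ∧ ∀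 σ, Literature.MathematicalPhysics.KineticTheory.HeatConduction.liouvilleZ (Literature.MathematicalPhysics.KineticTheory.HeatConduction.pinnedChain ω₂ lam β γ) Q σ = G (Literature.MathematicalPhysics.KineticTheory.HeatConduction.shift σ) - G σ; let Cov : (Literature.MathematicalPhysics.KineticTheory.HeatConduction.ChainConfig → ℝ) → (Literature.MathematicalPhysics.KineticTheory.HeatConduction.ChainConfig → ℝ) → ℝ → ℤ → ℝ := fun f g t x => MeasureTheory.integral μ (fun σ => f (D.flow t σ) * g (fun y => σ (y + x))) - MeasureTheory.integral μ (fun σ => f (D.flow t σ)) * MeasureTheory.integral μ (fun σ => g (fun y => σ (y + x))); (∀ f g : Literature.MathematicalPhysics.KineticTheory.HeatConduction.ChainConfig → ℝ, LocObs f → LocObs g → (∀ (t : ℝ) (x : ℤ), MeasureTheory.Integrable (fun σ => f (D.flow t σ) * g (fun y => σ (y + x))) μ) ∧ (∀ t₀ : ℝ, ∃ m : ℤ → ℝ, Summable m ∧ ∀ t ∈ Set.Icc (0 : ℝ) t₀, ∀ x : ℤ, |Cov f g t x| ≤ m x) ∧ (∀ x : ℤ, Continuous (fun t : ℝ => Cov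 f g t x)) ∧ Continuous (fun t : ℝ => ∑' x : ℤ, Cov f g t x)) → ∀ f : Literature.MathematicalPhysics.KineticTheory.HeatConduction.ChainConfig → ℝ, LocObs f → ∀ ε : ℝ, 0 < ε → ∃ Q : Literature.MathematicalPhysics.KineticTheory.HeatConduction.ChainConfig → ℝ, LocPoly Q ∧ Cons Q ∧ 0 < ∑' x : ℤ, Cov Q Q 0 x ∧ Filter.Eventually (fun τ : ℝ => τ⁻¹ * intervalIntegral (fun t : ℝ => ∑' x : ℤ, Cov f f t x) 0 τ MeasureTheory.volume ≤ (∑' x : ℤ, Cov f Q 0 x) ^ 2 / (∑' x : ℤ, Cov Q Q 0 x) + ε) Filter.atTop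

/-- item stmt-AtomisticToContinuum-17667 · crux · rank 4 · open · by planner
why it might fail: 'No ballistic channel' for EVERY odd local observable and symmetric set-up: an odd pseudolocal conserved vector overlapping some odd f (not necessarily j) refutes it; false at the excluded harmonic corner lam = β = 0; real-time ergodicity input unproved for anharmonic chains.
sources: Doyon2022, Mazur1969, Suzuki1971, LepriLiviPoliti2003, BonettoLebowitzReyBellet2000, decl Literature.Barriers.AtomisticToContinuum.MazurBoundBallisticNarrow
[crux · piece 2/2 of the parity split of ChargeCompleteness (crux-strategist BC2 redirect,
2026-08-17)] NO ODD DRUDE WEIGHT: for every symmetric set-up with the GibbsClustering clauses and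
every momentum-ODD f ∈ LocObs (f∘R = −f; e.g. the clipped currents F_M(j_x), p_x, p_x·h(q)) the
Cesàro mean τ⁻¹∫₀^τ K_f dt of the zero-wavenumber autocorrelation K_f(t) = Σ_x Cov(f∘φ_t, f∘shift^x)
tends to 0 — 'no ballistic channel in the whole odd sector' (Suzuki: ‖P_{𝒬₀} f‖² = 0 for odd f, i.e.
𝒬₀ ⊥ ℋ₀^odd, i.e. every pseudolocal conserved vector at k = 0 is momentum-even). This is the part of
the parent that HydroBridge actually consumes (at f = F_M(j_0)); under LocalChargeClassification it
is exactly ChargeCompleteness on the odd sector (every local polynomial charge is then even up to a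
telescope, so ⟨f,Q⟩₀ = 0 and the Mazur bound degenerates to D_f ≤ ε). Strictly between the retired
ZeroDrudeWeight (stmt-3657: ∃(μ,D), current only) / NoTruncatedDrude (stmt-11030: clipped current, ∀
set-up) below and ChargeCompleteness ∧ LocalChargeClassification above. [deps: GibbsClustering]
[difficulty: open-problem] -/
@[route_item "route-AtomisticToContinuum-NoHiddenChargesKubo"]
def NoOddDrudeWeight : Prop :=
  ∀ ω₂ lam β γ : ℝ, 0 < ω₂ → 0 < lam → 0 < β → ∀ T : ℝ, 0 < T → ∀ μ : MeasureTheory.Measure Literature.MathematicalPhysics.KineticTheory.HeatConduction.ChainConfig, (Literature.MathematicalPhysics.KineticTheory.HeatConduction.pinnedChain ω₂ lam β γ).IsChainGibbsMeasure T μ → Literature.MathematicalPhysics.KineticTheory.HeatConduction.IsShiftInvariant μ → μ.map (fun σ : Literature.MathematicalPhysics.KineticTheory.HeatConduction.ChainConfig => fun x : ℤ => ((σ x).1, -(σ x).2)) = μ → ∀ D : Literature.MathematicalPhysics.KineticTheory.HeatConduction.InfiniteChainDynamics (Literature.MathematicalPhysics.KineticTheory.HeatConduction.pinnedChain ω₂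 lam β γ), D.PreservesMeasure μ → (∀ t : ℝ, ∀ᵐ σ ∂μ, D.flow t (Literature.MathematicalPhysics.KineticTheory.HeatConduction.shift σ) = Literature.MathematicalPhysics.KineticTheory.HeatConduction.shift (D.flow t σ)) → let LocObs : (Literature.MathematicalPhysics.KineticTheory.HeatConduction.ChainConfig → ℝ) → Prop := fun f => ∃ (a : ℤ) (n : ℕ) (g : (Fin (n + 1) → ℝ × ℝ) → ℝ), Continuous g ∧ (∃ (C : ℝ) (k : ℕ), ∀ v, |g v| ≤ C * (1 + ‖v‖) ^ k) ∧ ∀ σ, f σ = g (Literature.MathematicalPhysics.KineticTheory.HeatConduction.boxRestrictAt a n σ); let Cov : (Literature.MathematicalPhysics.KineticTheory.HeatConduction.ChainConfig → ℝ) → (Literature.MathematicalPhysics.KineticTheory.HeatConduction.ChainConfig → ℝ) → ℝ → ℤ → ℝ := fun f g t x => MeasureTheory.integral μ (fun σ => f (D.flow t σ) * g (fun y => σ (y + x))) - MeasureTheory.integral μ (fun σ => f (D.flow t σ)) * MeasureTheory.integral μ (fun σ => g (fun y => σ (y + x))); (∀ f g : Literature.MathematicalPhysics.KineticTheory.HeatConduction.ChainConfig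 → ℝ, LocObs f → LocObs g → (∀ (t : ℝ) (x : ℤ), MeasureTheory.Integrable (fun σ => f (D.flow t σ) * g (fun y => σ (y + x))) μ) ∧ (∀ t₀ : ℝ, ∃ m : ℤ → ℝ, Summable m ∧ ∀ t ∈ Set.Icc (0 : ℝ) t₀, ∀ x : ℤ, |Cov f g t x| ≤ m x) ∧ (∀ x : ℤ, Continuous (fun t : ℝ => Cov f g t x)) ∧ Continuous (fun t : ℝ => ∑' x : ℤ, Cov f g t x)) → ∀ f : Literature.MathematicalPhysics.KineticTheory.HeatConduction.ChainConfig → ℝ, LocObs f → (∀ σ, f (fun x : ℤ => ((σ x).1, -(σ x).2)) = -f σ) → Filter.Tendsto (fun τ : ℝ => τ⁻¹ * intervalIntegral (fun t : ℝ => ∑' x : ℤ, Cov f f t x) 0 τ MeasureTheory.volume) Filter.atTop (nhds 0)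

/-- item stmt-AtomisticToContinuum-11029 · crux · rank 5 · open · by planner
why it might fail: = stmt-0703 minus the atom at 0: zero Cesàro mean gives neither C_T ∈ L¹ (kinetic FPU-β tail t^(-3/5) unpinned, LukkarinenSpohn2008; breather tails at low T) nor κ_GK > 0; summable C_T needs unprinted quartic-V propagation bounds.
sources: BonettoLebowitzReyBellet2000, Bernardin2014, LukkarinenSpohn2008, AokiLukkarinenSpohn2006, Spohn2014, Mazur1969
[crux] IMPORT SLOT ('Green–Kubo minus the ballistic atom'): for all parameters > 0 and T > 0, IF for
every symmetric set-up (μ_T, φ) and every M the truncated Drude weight vanishes in the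
NoTruncatedDrude form (∀η ∃τ₀ ∀τ≥τ₀ ∃L₀ ∀L≥L₀ |A_M(L,τ)| ≤ η), THEN there are a Gibbs state and a
μ_T-preserving dynamics with HasGreenKubo (C_T absolutely convergent, in L¹(0,∞), κ_GK > 0) —
literally the body of crux FourierGreenKubo (stmt-AtomisticToContinuum-0703) at T. NOT this route's
mechanism: the residual is the REGULAR part of the current spectral measure σ_T near 0 (integrable
Fourier transform, positive density), the object of cards herglotz-current-spectral-measure /
embedded-drude-eigenvalue-mourre-fgr and of route FourierGreenKubo; any decay proof of 0703 closes
it a fortiori. [deps: NoTruncatedDrude, SymmetricSetup] [difficulty: open-problem] -/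
@[route_item "route-AtomisticToContinuum-NoHiddenChargesKubo", crux]
def GreenKuboOfNoDrude : Prop :=
  ∀ ω₂ lam β γ : ℝ, 0 < ω₂ → 0 < lam → 0 < β → 0 < γ → ∀ T : ℝ, 0 < T → (∀ μ : MeasureTheory.Measure Literature.MathematicalPhysics.KineticTheory.HeatConduction.ChainConfig, (Literature.MathematicalPhysics.KineticTheory.HeatConduction.pinnedChain ω₂ lam β γ).IsChainGibbsMeasure T μ → Literature.MathematicalPhysics.KineticTheory.HeatConduction.IsShiftInvariant μ → μ.map (fun σ : Literature.MathematicalPhysics.KineticTheory.HeatConduction.ChainConfig => fun x : ℤ => ((σ x).1, -(σ x).2)) = μ → ∀ D : Literature.MathematicalPhysics.KineticTheory.HeatConduction.InfiniteChainDynamics (Literature.MathematicalPhysics.KineticTheory.HeatConduction.pinnedChain ω₂ lam β γ), D.PreservesMeasure μ → (∀ t : ℝ, ∀ᵐ σ ∂μ, D.flow t (Literature.MathematicalPhysics.KineticTheory.HeatConduction.shift σ) = Literature.MathematicalPhysics.KineticTheory.HeatConduction.shift (D.flow t σ)) → ∀ M : ℝ, 0 < M → ∀ F : ℝ → ℝ,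 F = (fun u : ℝ => max (-M) (min M u)) → ∀ η : ℝ, 0 < η → ∃ τ₀ : ℝ, ∀ τ : ℝ, τ₀ ≤ τ → ∃ L₀ : ℕ, ∀ L : ℕ, L₀ ≤ L → ∀ G : Literature.MathematicalPhysics.KineticTheory.HeatConduction.ChainConfig → ℝ, G = (fun σ : Literature.MathematicalPhysics.KineticTheory.HeatConduction.ChainConfig => ∑ x ∈ Finset.Icc (-(L : ℤ)) (L : ℤ), F ((Literature.MathematicalPhysics.KineticTheory.HeatConduction.pinnedChain ω₂ lam β γ).bondCurrentZ σ x)) → |(τ⁻¹ * ∫ t in (0:ℝ)..τ, ((∫ σ, F ((Literature.MathematicalPhysics.KineticTheory.HeatConduction.pinnedChain ω₂ lam β γ).bondCurrentZ (D.flow t σ) 0) * G σ ∂μ) - (∫ σ, F ((Literature.MathematicalPhysics.KineticTheory.HeatConduction.pinnedChain ω₂ lam β γ).bondCurrentZ (D.flow t σ) 0) ∂μ) * (∫ σ, G σ ∂μ)))| ≤ η) → ∃ μ : MeasureTheory.Measure Literature.MathematicalPhysics.KineticTheory.HeatConduction.ChainConfig, (Literature.MathematicalPhysics.KineticTheory.HeatConduction.pinnedChain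 ω₂ lam β γ).IsChainGibbsMeasure T μ ∧ ∃ D : Literature.MathematicalPhysics.KineticTheory.HeatConduction.InfiniteChainDynamics (Literature.MathematicalPhysics.KineticTheory.HeatConduction.pinnedChain ω₂ lam β γ), D.PreservesMeasure μ ∧ D.HasGreenKubo μ T

/-- item stmt-AtomisticToContinuum-17666 · crux · rank 6 · open · by planner
why it might fail: Even half of Doyon's completeness problem: a pseudolocal momentum-EVEN flow-invariant vector of ℋ₀ outside the ℋ₀-closure of local polynomial charges (long-lived breathers / KAM-like islands at low T, strong pinning) breaks it; no theorem of this kind exists for any anharmonic lattice.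
sources: Doyon2022, AmpelogiannisDoyon2026, doi:10.1007/s00220-022-04310-3, Shiraishi2019, Mazur1969, Suzuki1971
[crux · piece 1/2 of the parity split of ChargeCompleteness (crux-strategist BC2 redirect,
2026-08-17)] EVEN-SECTOR COMPLETENESS OF LOCAL CHARGES AT WAVENUMBER 0: for every symmetric set-up
(DLR Gibbs μ_T shift- and reversal-invariant, μ_T-preserving dynamics commuting with the shift a.e.)
with the GibbsClustering clauses and every momentum-EVEN f ∈ LocObs (f∘R = f, R : p ↦ −p), for every
ε > 0 there is a momentum-EVEN local polynomial conserved density Q (Cons Q, Q∘R = Q, ‖Q‖₀² = Σ_x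
Cov(Q,Q;0,x) > 0) with τ⁻¹∫₀^τ K_f dt eventually ≤ ⟨f,Q⟩₀²/‖Q‖₀² + ε. = ChargeCompleteness
restricted to the even sector, with an even saturating charge (the even part Qe of any conserved Q
is conserved, since liouvilleZ anticommutes with R, and saturates at least as well whenever ‖Qe‖₀ >
0). With LocalChargeClassification it reads 𝒬₀^even = ℝ·[e₀]: the Drude weight of every even local
observable is its energy projection ⟨f,e₀⟩₀²/‖e₀‖₀² — k = 0 hydrodynamic ergodicity of the EVEN
sector, a statement about heat-mode saturation that is logically independent of the anti-ballistic
(odd) statement and is NOT used by HydroBridge for the current (odd); it is what makes the parent a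
completeness statement rat -/
@[route_item "route-AtomisticToContinuum-NoHiddenChargesKubo"]
def EvenChargeCompleteness : Prop :=
  ∀ ω₂ lam β γ : ℝ, 0 < ω₂ → 0 < lam → 0 < β → ∀ T : ℝ, 0 < T → ∀ μ : MeasureTheory.Measure Literature.MathematicalPhysics.KineticTheory.HeatConduction.ChainConfig, (Literature.MathematicalPhysics.KineticTheory.HeatConduction.pinnedChain ω₂ lam β γ).IsChainGibbsMeasure T μ → Literature.MathematicalPhysics.KineticTheory.HeatConduction.IsShiftInvariant μ → μ.map (fun σ : Literature.MathematicalPhysics.KineticTheory.HeatConduction.ChainConfig => fun x : ℤ => ((σ x).1, -(σ x).2)) = μ → ∀ D : Literature.MathematicalPhysics.KineticTheory.HeatConduction.InfiniteChainDynamics (Literature.MathematicalPhysics.KineticTheory.HeatConduction.pinnedChain ω₂ lam β γ), D.PreservesMeasure μ → (∀ t : ℝ, ∀ᵐ σ ∂μ, D.flow t (Literature.MathematicalPhysics.KineticTheory.HeatConduction.shift σ) = Literature.MathematicalPhysics.KineticTheory.HeatConduction.shift (D.flow t σ)) → let LocPoly : (Literature.MathematicalPhysics.KineticTheory.HeatConduction.ChainConfig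 → ℝ) → Prop := fun f => ∃ (a : ℤ) (n : ℕ) (w : MvPolynomial (Fin (n + 1) × Bool) ℝ), ∀ σ, f σ = MvPolynomial.eval (fun v : Fin (n + 1) × Bool => if v.2 then (Literature.MathematicalPhysics.KineticTheory.HeatConduction.boxRestrictAt a n σ v.1).2 else (Literature.MathematicalPhysics.KineticTheory.HeatConduction.boxRestrictAt a n σ v.1).1) w; let LocObs : (Literature.MathematicalPhysics.KineticTheory.HeatConduction.ChainConfig → ℝ) → Prop := fun f => ∃ (a : ℤ) (n : ℕ) (g : (Fin (n + 1) → ℝ × ℝ) → ℝ), Continuous g ∧ (∃ (C : ℝ) (k : ℕ), ∀ v, |g v| ≤ C * (1 + ‖v‖) ^ k) ∧ ∀ σ, f σ = g (Literature.MathematicalPhysics.KineticTheory.HeatConduction.boxRestrictAt a n σ); let Cons : (Literature.MathematicalPhysics.KineticTheory.HeatConduction.ChainConfig → ℝ) → Prop := fun Q => ∃ G : Literature.MathematicalPhysics.KineticTheory.HeatConduction.ChainConfig → ℝ, LocPoly G ∧ ∀ σ, Literature.MathematicalPhysics.KineticTheory.HeatConduction.liouvilleZ (Literature.MathematicalPhysics.KineticTheory.HeatConduction.pinnedChain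 ω₂ lam β γ) Q σ = G (Literature.MathematicalPhysics.KineticTheory.HeatConduction.shift σ) - G σ; let Cov : (Literature.MathematicalPhysics.KineticTheory.HeatConduction.ChainConfig → ℝ) → (Literature.MathematicalPhysics.KineticTheory.HeatConduction.ChainConfig → ℝ) → ℝ → ℤ → ℝ := fun f g t x => MeasureTheory.integral μ (fun σ => f (D.flow t σ) * g (fun y => σ (y + x))) - MeasureTheory.integral μ (fun σ => f (D.flow t σ)) * MeasureTheory.integral μ (fun σ => g (fun y => σ (y + x))); (∀ f g : Literature.MathematicalPhysics.KineticTheory.HeatConduction.ChainConfig → ℝ, LocObs f → LocObs g → (∀ (t : ℝ) (x : ℤ), MeasureTheory.Integrable (fun σ => f (D.flow t σ) * g (fun y => σ (y + x))) μ) ∧ (∀ t₀ : ℝ, ∃ m : ℤ → ℝ, Summable m ∧ ∀ t ∈ Set.Icc (0 : ℝ) t₀, ∀ x : ℤ, |Cov f g t x| ≤ m x) ∧ (∀ x : ℤ, Continuous (fun t : ℝ => Cov f g t x)) ∧ Continuous (fun t : ℝ => ∑' x : ℤ, Cov f g t x)) → ∀ f : Literature.MathematicalPhysics.KineticTheory.HeatConduction.ChainConfig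 → ℝ, LocObs f → (∀ σ, f (fun x : ℤ => ((σ x).1, -(σ x).2)) = f σ) → ∀ ε : ℝ, 0 < ε → ∃ Q : Literature.MathematicalPhysics.KineticTheory.HeatConduction.ChainConfig → ℝ, LocPoly Q ∧ Cons Q ∧ (∀ σ, Q (fun x : ℤ => ((σ x).1, -(σ x).2)) = Q σ) ∧ 0 < ∑' x : ℤ, Cov Q Q 0 x ∧ Filter.Eventually (fun τ : ℝ => τ⁻¹ * intervalIntegral (fun t : ℝ => ∑' x : ℤ, Cov f f t x) 0 τ MeasureTheory.volume ≤ (∑' x : ℤ, Cov f Q 0 x) ^ 2 / (∑' x : ℤ, Cov Q Q 0 x) + ε) Filter.atTop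

/-- item stmt-AtomisticToContinuum-0717 · support · rank 9 · closed · proved by Summit.AtomisticToContinuum.FouriersLaw.Theorems.FourierGreenKubo.finiteResponseOfUnique_holds (prover) · by planner
sources: HairerMajda2009, ReyBellet2003
CONDITIONAL FORM OF 0705 (supersedes it as the prover target; refuters pool-5/g3-0: 0705 stand-alone
quantifies over EVERY steady-state family and is false-prone if weak steady states were non-unique):
assuming UNIQUENESS of weak steady states (IsSteadyState class) for pinnedChain at all N, T_L, T_R >
0, the finite-N linear-response limit D_N(T) = lim_{δ→0, δ≠0} totalCurrent(μ_{N,T+δ/2,T−δ/2})/δ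
exists for every T > 0 and N. Content: differentiability at equilibrium of NESS expectations of the
polynomial currents in the bath temperatures (ReyBellet2003 arXiv:math-ph/0303021 Rem 4.4 (51)–(56)
finite-volume Green–Kubo; HairerMajda2009 arXiv:0909.4313 Thm 2.3 framework — their SDE Thm 4.4
Assumption 5 fails here, so verify Assumptions 1–3 via CEHR2018 (2.5)/Carmona2007 Thm 1.1(iv)
weighted spectral gap). N = 0, 1: totalCurrent ≡ 0, D = 0. Together with 0706 gives 0705. -/
@[route_item "route-AtomisticToContinuum-NoHiddenChargesKubo", crux]
def FiniteResponseOfUnique : Prop :=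
  ∀ ω₂ lam β γ : ℝ, 0 < ω₂ → 0 < lam → 0 < β → 0 < γ → (∀ (N : ℕ) (T_L T_R : ℝ), 0 < T_L → 0 < T_R → ∀ μ ν : MeasureTheory.Measure (Literature.MathematicalPhysics.KineticTheory.HeatConduction.PhaseSpace N), (Literature.MathematicalPhysics.KineticTheory.HeatConduction.pinnedChain ω₂ lam β γ).IsSteadyState N T_L T_R μ → (Literature.MathematicalPhysics.KineticTheory.HeatConduction.pinnedChain ω₂ lam β γ).IsSteadyState N T_L T_R ν → μ = ν) → ∀ μ : (N : ℕ) → ℝ → ℝ → MeasureTheory.Measure (Literature.MathematicalPhysics.KineticTheory.HeatConduction.PhaseSpace N), (∀ (N : ℕ) (T_L T_R : ℝ), 0 < T_L → 0 < T_R → (Literature.MathematicalPhysics.KineticTheory.HeatConduction.pinnedChain ω₂ lam β γ).IsSteadyState N T_L T_R (μ N T_L T_R)) → ∀ T : ℝ, 0 < T → ∀ N : ℕ, ∃ D : ℝ, Filter.Tendsto (fun δ : ℝ => (Literature.MathematicalPhysics.KineticTheory.HeatConduction.pinnedChain ω₂ lam β γ).totalCurrent (μ N (T + δ / 2) (T -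 δ / 2)) / δ) (nhdsWithin 0 {(0 : ℝ)}ᶜ) (nhds D)

/-- `FiniteResponseOfUnique` holds: proved by `Summit.AtomisticToContinuum.FouriersLaw.Theorems.FourierGreenKubo.finiteResponseOfUnique_holds`. -/
theorem FiniteResponseOfUnique_holds : FiniteResponseOfUnique := _root_.Summit.AtomisticToContinuum.FouriersLaw.Theorems.FourierGreenKubo.finiteResponseOfUnique_holds

/-- item stmt-AtomisticToContinuum-0741 · support · rank 9 · closed · proved by Summit.AtomisticToContinuum.FouriersLaw.Theorems.nessUnique_proof (prover) · by planner
sources: CuneoEckmannHairerReyBellet2018, ReyBellet2003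
[crux] UNIQUENESS OF THE WEAK STEADY STATE (the half of stmt-0706 not covered by the landed fact
Literature.MathematicalPhysics.KineticTheory.HeatConduction.CuneoEckmannHairerReyBellet2018_pinnedChain,
p3544): for pinnedChain ω₂ lam β γ (all > 0), every N and T_L, T_R > 0, any two measures in the weak
Fokker–Planck class IsSteadyState (probability, ∫ L f dμ = 0 for f ∈ C_c^∞, bond currents
integrable) coincide. Print: uniqueness of the INVARIANT MEASURE of the Langevin semigroup
(CuneoEckmannHairerReyBellet2018 Thm 2.13(1): C1, C2, CA; Carmona2007 Thm 1.1(iii)); the item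
additionally needs 'weak stationary probability solution of L*μ = 0 ⇒ P_t-invariant' for this
hypoelliptic L with cubic drift (Echeverría 1982 well-posed martingale problem on C_c^∞ +
non-explosion via e^{θH}; Bogachev–Krylov–Röckner–Shaposhnikov 2015 Ch. 5 is non-degenerate only) —
the FP-identification lemma is the formal crux. N = 0: PhaseSpace 0 is a point (unique probability
measure); N = 1: both baths on site 0, OU at temperature (T_L+T_R)/2. This is exactly the hypothesis
of FiniteResponse and ThermodynamicLimit and, with the fact, gives clause (i) of FouriersLawFor. -/
@[route_item "route-AtomisticToContinuum-NoHiddenChargesKubo", crux]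
def NessUnique : Prop :=
  ∀ ω₂ lam β γ : ℝ, 0 < ω₂ → 0 < lam → 0 < β → 0 < γ → ∀ (N : ℕ) (T_L T_R : ℝ), 0 < T_L → 0 < T_R → ∀ μ ν : MeasureTheory.Measure (Literature.MathematicalPhysics.KineticTheory.HeatConduction.PhaseSpace N), (Literature.MathematicalPhysics.KineticTheory.HeatConduction.pinnedChain ω₂ lam β γ).IsSteadyState N T_L T_R μ → (Literature.MathematicalPhysics.KineticTheory.HeatConduction.pinnedChain ω₂ lam β γ).IsSteadyState N T_L T_R ν → μ = ν

/-- `NessUnique` holds: proved by `Summit.AtomisticToContinuum.FouriersLaw.Theorems.nessUnique_proof`. -/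
theorem NessUnique_holds : NessUnique := _root_.Summit.AtomisticToContinuum.FouriersLaw.Theorems.nessUnique_proof

/-- item stmt-AtomisticToContinuum-0742 · support · rank 9 · open · by planner
sources: BonettoLebowitzReyBellet2000, Dhar2008, ReyBellet2003
[crux] THERMODYNAMIC LIMIT OF THE RESPONSE COEFFICIENT, WITNESS FORM (supersedes
stmt-AtomisticToContinuum-0704; refuters g12-0/1/2/3/5: the ∀(μ_T,D) form hid the claim that κ_GK is
the same for every DLR state and every dynamics). Under weak-NESS uniqueness and T > 0, IF some
Gibbs state with a μ_T-preserving Green–Kubo dynamics exists (hypothesis = GreenKubo at T), THEN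
there is such a pair (μ_T, D), fixed before the steady-state family is chosen, such that for every
steady-state family μ and every sequence Dn of finite-volume response coefficients (Dn N =
lim_{δ→0,δ≠0} totalCurrent(μ N (T+δ/2) (T−δ/2))/δ, existence = FiniteResponse, uniqueness of limits
makes Dn canonical) one has Dn → greenKuboConductivity D μ_T T. Content: finite-volume Kubo formula
(ReyBellet2003 Rem 4.4 (56)) + N-uniform decay of equilibrium current correlations of the Langevin
chain + o(1) boundary layers at the baths; open (BonettoLebowitzReyBellet2000 §7 after (37)). N = 0,
1: Dn = 0, irrelevant to atTop. -/
@[route_item "route-AtomisticToContinuum-NoHiddenChargesKubo", crux]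
def ThermodynamicLimit : Prop :=
  ∀ ω₂ lam β γ : ℝ, 0 < ω₂ → 0 < lam → 0 < β → 0 < γ → (∀ (N : ℕ) (T_L T_R : ℝ), 0 < T_L → 0 < T_R → ∀ μ ν : MeasureTheory.Measure (Literature.MathematicalPhysics.KineticTheory.HeatConduction.PhaseSpace N), (Literature.MathematicalPhysics.KineticTheory.HeatConduction.pinnedChain ω₂ lam β γ).IsSteadyState N T_L T_R μ → (Literature.MathematicalPhysics.KineticTheory.HeatConduction.pinnedChain ω₂ lam β γ).IsSteadyState N T_L T_R ν → μ = ν) → ∀ T : ℝ, 0 < T → (∃ μT : MeasureTheory.Measure Literature.MathematicalPhysics.KineticTheory.HeatConduction.ChainConfig, (Literature.MathematicalPhysics.KineticTheory.HeatConduction.pinnedChain ω₂ lam β γ).IsChainGibbsMeasure T μT ∧ ∃ D : Literature.MathematicalPhysics.KineticTheory.HeatConduction.InfiniteChainDynamics (Literature.MathematicalPhysics.KineticTheory.HeatConduction.pinnedChain ω₂ lam β γ), D.PreservesMeasure μT ∧ D.HasGreenKubo μT T) → ∃ (μT : MeasureTheory.Measure Literature.MathematicalPhysics.KineticTheory.HeatConduction.ChainConfig)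 (D : Literature.MathematicalPhysics.KineticTheory.HeatConduction.InfiniteChainDynamics (Literature.MathematicalPhysics.KineticTheory.HeatConduction.pinnedChain ω₂ lam β γ)), (Literature.MathematicalPhysics.KineticTheory.HeatConduction.pinnedChain ω₂ lam β γ).IsChainGibbsMeasure T μT ∧ D.PreservesMeasure μT ∧ D.HasGreenKubo μT T ∧ ∀ μ : (N : ℕ) → ℝ → ℝ → MeasureTheory.Measure (Literature.MathematicalPhysics.KineticTheory.HeatConduction.PhaseSpace N), (∀ (N : ℕ) (T_L T_R : ℝ), 0 < T_L → 0 < T_R → (Literature.MathematicalPhysics.KineticTheory.HeatConduction.pinnedChain ω₂ lam β γ).IsSteadyState N T_L T_R (μ N T_L T_R)) → ∀ Dn : ℕ → ℝ, (∀ N : ℕ, Filter.Tendsto (fun δ : ℝ => (Literature.MathematicalPhysics.KineticTheory.HeatConduction.pinnedChain ω₂ lam β γ).totalCurrent (μ N (T + δ / 2) (T - δ / 2)) / δ) (nhdsWithin 0 {(0 : ℝ)}ᶜ) (nhds (Dn N))) → Filter.Tendsto Dn Filter.atTop (nhds (D.greenKuboConductivity μT T))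

/-- item stmt-AtomisticToContinuum-11030 · support · rank 9 · open · by planner
sources: Mazur1969, Suzuki1971, Doyon2022
[support] THE DELIVERABLE (no ballistic channel, truncated form): for every symmetric set-up (μ_T,
φ) of pinnedChain (ω₂, lam, β > 0), T > 0, every M, η > 0: ∃τ₀ ∀τ≥τ₀ ∃L₀ ∀L≥L₀ |τ⁻¹∫₀^τ
Cov_{μ_T}(G_L, F_M(j_0)∘φ_t)dt| ≤ η. Closed by BridgeGlue from ranks 2–4; stated alone so that
FourierGreenKubo (Cesàro half of stmt-0703), the Herglotz card and the junction/Fekete lines can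
want it. [difficulty: L] -/
@[route_item "route-AtomisticToContinuum-NoHiddenChargesKubo"]
def NoTruncatedDrude : Prop :=
  ∀ ω₂ lam β γ : ℝ, 0 < ω₂ → 0 < lam → 0 < β → ∀ T : ℝ, 0 < T → ∀ μ : MeasureTheory.Measure Literature.MathematicalPhysics.KineticTheory.HeatConduction.ChainConfig, (Literature.MathematicalPhysics.KineticTheory.HeatConduction.pinnedChain ω₂ lam β γ).IsChainGibbsMeasure T μ → Literature.MathematicalPhysics.KineticTheory.HeatConduction.IsShiftInvariant μ → μ.map (fun σ : Literature.MathematicalPhysics.KineticTheory.HeatConduction.ChainConfig => fun x : ℤ => ((σ x).1, -(σ x).2)) = μ → ∀ D : Literature.MathematicalPhysics.KineticTheory.HeatConduction.InfiniteChainDynamics (Literature.MathematicalPhysics.KineticTheory.HeatConduction.pinnedChain ω₂ lam β γ), D.PreservesMeasure μ → (∀ t : ℝ, ∀ᵐ σ ∂μ, D.flow t (Literature.MathematicalPhysics.KineticTheory.HeatConduction.shift σ) = Literature.MathematicalPhysics.KineticTheory.HeatConduction.shift (D.flow t σ)) → ∀ M : ℝ, 0 < M → ∀ F : ℝ → ℝ,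 F = (fun u : ℝ => max (-M) (min M u)) → ∀ η : ℝ, 0 < η → ∃ τ₀ : ℝ, ∀ τ : ℝ, τ₀ ≤ τ → ∃ L₀ : ℕ, ∀ L : ℕ, L₀ ≤ L → ∀ G : Literature.MathematicalPhysics.KineticTheory.HeatConduction.ChainConfig → ℝ, G = (fun σ : Literature.MathematicalPhysics.KineticTheory.HeatConduction.ChainConfig => ∑ x ∈ Finset.Icc (-(L : ℤ)) (L : ℤ), F ((Literature.MathematicalPhysics.KineticTheory.HeatConduction.pinnedChain ω₂ lam β γ).bondCurrentZ σ x)) → |(τ⁻¹ * ∫ t in (0:ℝ)..τ, ((∫ σ, F ((Literature.MathematicalPhysics.KineticTheory.HeatConduction.pinnedChain ω₂ lam β γ).bondCurrentZ (D.flow t σ) 0) * G σ ∂μ) - (∫ σ, F ((Literature.MathematicalPhysics.KineticTheory.HeatConduction.pinnedChain ω₂ lam β γ).bondCurrentZ (D.flow t σ) 0) ∂μ) * (∫ σ, G σ ∂μ)))| ≤ η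

/-- item stmt-AtomisticToContinuum-11036 · support · rank 9 · closed · proved by Summit.AtomisticToContinuum.FouriersLaw.Theorems.CurrentTiltQuench.hoelderEscapeProfile_symmetricSetup_proof @ 7ae88a1c43c2 (prover) · by planner
sources: LanfordLebowitzLieb1977, ButtaMarchioro2016, ButtaEtAl2007, Georgii2011
[support] DE-VACUIFIER / infrastructure (InfiniteVolumeSetup = stmt-0743 of FourierGreenKubo
strengthened by the symmetries this line uses): for ω₂, lam, β > 0 (any γ) and T > 0 there are a DLR
Gibbs state μ_T that is shift-invariant and momentum-reversal invariant (1-D transfer operator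
e^(−U/2T)e^(−V(q′−q)/T)e^(−U/2T), Hilbert–Schmidt since U ≥ ω₂q²/2: unique, hence symmetric) and an
InfiniteChainDynamics preserving μ_T whose flow commutes with the shift μ_T-a.e. (LLL1977 Thm 3 a.e.
existence on a shift-invariant tempered carrier + a uniqueness class; ButtaEtAl2007 for quartic
forces). [difficulty: L] -/
@[route_item "route-AtomisticToContinuum-NoHiddenChargesKubo"]
def SymmetricSetup : Prop :=
  ∀ ω₂ lam β γ : ℝ, 0 < ω₂ → 0 < lam → 0 < β → ∀ T : ℝ, 0 < T → ∃ μ : MeasureTheory.Measure Literature.MathematicalPhysics.KineticTheory.HeatConduction.ChainConfig, (Literature.MathematicalPhysics.KineticTheory.HeatConduction.pinnedChain ω₂ lam β γ).IsChainGibbsMeasure T μ ∧ Literature.MathematicalPhysics.KineticTheory.HeatConduction.IsShiftInvariant μ ∧ μ.map (fun σ : Literature.MathematicalPhysics.KineticTheory.HeatConduction.ChainConfig => fun x : ℤ => ((σ x).1, -(σ x).2)) = μ ∧ ∃ D : Literature.MathematicalPhysics.KineticTheory.HeatConduction.InfiniteChainDynamics (Literature.MathematicalPhysics.KineticTheory.HeatConduction.pinnedChain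 ω₂ lam β γ), D.PreservesMeasure μ ∧ ∀ t : ℝ, ∀ᵐ σ ∂μ, D.flow t (Literature.MathematicalPhysics.KineticTheory.HeatConduction.shift σ) = Literature.MathematicalPhysics.KineticTheory.HeatConduction.shift (D.flow t σ)

/-- item stmt-AtomisticToContinuum-11916 · support · rank 9 · open · by planner
sources: Doyon2022, Mazur1969, Suzuki1971, decl Literature.Barriers.AtomisticToContinuum.Mazur.tendsto_inv_mul_integral_inner
[support] CLASSICAL HYDRODYNAMIC PROJECTION AT κ = 0, existence half (Doyon2022 Thm 5.1
transplanted; von Neumann / Bochner): for every symmetric set-up with the GibbsClustering clauses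
and every f ∈ LocObs the Cesàro mean τ⁻¹∫₀^τ K_f(t) dt converges to some D_f ≥ 0. Proof route: K_f
is continuous (clause iv) and positive-definite in t (Fejér: L⁻¹Var(Σ_(|x|<L) Σ_k c_k
f∘shift^x∘φ_(t_k)) ≥ 0, shift-invariance + stationarity + dominated clustering), hence the Fourier
transform of a finite positive measure σ_f and the Cesàro means tend to σ_f({0}) ≥ 0; or
GNS/Kolmogorov dilation + in-tree Mazur.tendsto_inv_mul_integral_inner. [difficulty: M] -/
@[route_item "route-AtomisticToContinuum-NoHiddenChargesKubo", crux]
def DrudeWeightExists : Prop :=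
  ∀ ω₂ lam β γ : ℝ, 0 < ω₂ → 0 < lam → 0 < β → ∀ T : ℝ, 0 < T → ∀ μ : MeasureTheory.Measure Literature.MathematicalPhysics.KineticTheory.HeatConduction.ChainConfig, (Literature.MathematicalPhysics.KineticTheory.HeatConduction.pinnedChain ω₂ lam β γ).IsChainGibbsMeasure T μ → Literature.MathematicalPhysics.KineticTheory.HeatConduction.IsShiftInvariant μ → μ.map (fun σ : Literature.MathematicalPhysics.KineticTheory.HeatConduction.ChainConfig => fun x : ℤ => ((σ x).1, -(σ x).2)) = μ → ∀ D : Literature.MathematicalPhysics.KineticTheory.HeatConduction.InfiniteChainDynamics (Literature.MathematicalPhysics.KineticTheory.HeatConduction.pinnedChain ω₂ lam β γ), D.PreservesMeasure μ → (∀ t : ℝ, ∀ᵐ σ ∂μ, D.flow t (Literature.MathematicalPhysics.KineticTheory.HeatConduction.shift σ) = Literature.MathematicalPhysics.KineticTheory.HeatConduction.shift (D.flow t σ)) → let LocObs : (Literature.MathematicalPhysics.KineticTheory.HeatConduction.ChainConfig → ℝ) → Prop := fun f => ∃ (a : ℤ) (n : ℕ) (g : (Fin (n + 1) → ℝ ×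 ℝ) → ℝ), Continuous g ∧ (∃ (C : ℝ) (k : ℕ), ∀ v, |g v| ≤ C * (1 + ‖v‖) ^ k) ∧ ∀ σ, f σ = g (Literature.MathematicalPhysics.KineticTheory.HeatConduction.boxRestrictAt a n σ); let Cov : (Literature.MathematicalPhysics.KineticTheory.HeatConduction.ChainConfig → ℝ) → (Literature.MathematicalPhysics.KineticTheory.HeatConduction.ChainConfig → ℝ) → ℝ → ℤ → ℝ := fun f g t x => MeasureTheory.integral μ (fun σ => f (D.flow t σ) * g (fun y => σ (y + x))) - MeasureTheory.integral μ (fun σ => f (D.flow t σ)) * MeasureTheory.integral μ (fun σ => g (fun y => σ (y + x))); (∀ f g : Literature.MathematicalPhysics.KineticTheory.HeatConduction.ChainConfig → ℝ, LocObs f → LocObs g → (∀ (t : ℝ) (x : ℤ), MeasureTheory.Integrable (fun σ => f (D.flow t σ) * g (fun y => σ (y + x))) μ) ∧ (∀ t₀ : ℝ, ∃ m : ℤ → ℝ, Summable m ∧ ∀ t ∈ Set.Icc (0 : ℝ) t₀, ∀ x : ℤ, |Cov f g t x| ≤ m x) ∧ (∀ x : ℤ, Continuous (fun t : ℝ =>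 Cov f g t x)) ∧ Continuous (fun t : ℝ => ∑' x : ℤ, Cov f g t x)) → ∀ f : Literature.MathematicalPhysics.KineticTheory.HeatConduction.ChainConfig → ℝ, LocObs f → ∃ Df : ℝ, 0 ≤ Df ∧ Filter.Tendsto (fun τ : ℝ => τ⁻¹ * intervalIntegral (fun t : ℝ => ∑' x : ℤ, Cov f f t x) 0 τ MeasureTheory.volume) Filter.atTop (nhds Df)

/-- item stmt-AtomisticToContinuum-11917 · support · rank 9 · open · by planner
sources: Mazur1969, Suzuki1971, Doyon2022, decl Literature.Barriers.AtomisticToContinuum.Mazur.starProjection_eq_zero_of_reversing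
[support] THE BRIDGE (elementary; ≈ 400–800 Lean lines, no new mathematics): GibbsClustering →
DrudeWeightExists → ChargeCompleteness → LocalChargeClassification → NoTruncatedDrude. Proof: fix a
symmetric set-up, M, F = clip_M, η; f := F∘(bondCurrentZ · 0) ∈ LocObs (continuous, bounded, box
{0,1}). DrudeWeightExists: τ⁻¹∫₀^τ K_f → D_f ≥ 0. ChargeCompleteness at (f, ε): a conserved Q ∈
LocPoly with ‖Q‖₀² > 0 and Cesàro means eventually ≤ ⟨f,Q⟩₀²/‖Q‖₀² + ε. LocalChargeClassification: Q
= c·e₀ + d + (G∘shift − G). Then ⟨f,Q⟩₀ = 0: Cov(f, e₀∘shift^x) = 0 because μ.map(p ↦ −p) = μ, f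
odd, e₀ even (flow 0 = id μ-a.e.); Cov(f, const) = 0; the telescopic part is Σ_x (a_(x+1) − a_x) = 0
for the summable a_x = Cov(f,G;0,x) (clause ii). Hence D_f ≤ ε for all ε, so D_f = 0. Finally the
11030 expression equals τ⁻¹∫₀^τ Σ_(|x|≤L) Cov(f,f;t,x) dt (F(bondCurrentZ σ x) = f(shift^x σ);
integral_finset_sum by clause i), and by clause (ii) on [0,τ] it is within Σ_(|x|>L) m x of τ⁻¹∫₀^τ
K_f: choose τ₀ ≥ 1 with |τ⁻¹∫₀^τ K_f| ≤ η/2 beyond it, then L₀ with the tail ≤ η/2. [difficulty: M] -/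
@[route_item "route-AtomisticToContinuum-NoHiddenChargesKubo", crux]
def HydroBridge : Prop :=
  GibbsClustering → DrudeWeightExists → ChargeCompleteness → LocalChargeClassification → NoTruncatedDrude

/-- item stmt-AtomisticToContinuum-17668 · support · rank 9 · open · by planner
sources: Mazur1969, Suzuki1971, Doyon2022, decl Literature.Barriers.AtomisticToContinuum.Mazur.starProjection_eq_zero_of_reversing
[glue · SPLIT GLUE of the deciding crux ChargeCompleteness — crux-strategist BC2 redirect (RESTATED
re-audit r1, 2026-08-17): ChargeCompleteness ⇐ EvenChargeCompleteness (new crux) ∧ NoOddDrudeWeight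
(new crux) ∧ DrudeWeightExists (this route's existing support item stmt-AtomisticToContinuum-11916).
PROVED against the tree: strategist's NoHiddenChargesKuboChargeCompletenessSplit.lean, theorem
chargeCompleteness_of_parity (lean check rc 0, 0 sorry, 0 warnings, axioms
propext/Classical.choice/Quot.sound; ≈330 tactic lines + 6 lemmas — NOT a one-line seam; attached as
evidence on stmt-11915 and on this item; Theorems/ is prover-only for the strategist seat (gate:
perm.theorems-prover-only), so a prover re-files that file verbatim at
Summits/AtomisticToContinuum/FouriersLaw/Theorems/NoHiddenChargesKuboChargeCompletenessSplit.lean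
with --workitem <this item>; the formal parent→children edge `route edit --split ChargeCompleteness
--into EvenChargeCompleteness NoOddDrudeWeight --glue-by <landed theorem>` is refused to a
non-final-cycle seat ('--split/ --resplit is available on a seat's FINAL cycle only') and is left to
the tenure planner]. Proof: split f = fe + fo into momentum-even/odd pa -/
@[route_item "route-AtomisticToContinuum-NoHiddenChargesKubo"]
def ChargeCompletenessOfParity : Prop :=
  EvenChargeCompleteness → NoOddDrudeWeight → DrudeWeightExists → ChargeCompleteness

/-- item stmt-AtomisticToContinuum-11918 · assembly · rank 1 · open · by planner
sources: BonettoLebowitzReyBellet2000, Doyon2022, decl Literature.MathematicalPhysics.KineticTheory.HeatConduction.pinnedChain_exists_isSteadyState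
[assembly] GibbsClustering → DrudeWeightExists → ChargeCompleteness → LocalChargeClassification →
HydroBridge → GreenKuboOfNoDrude → NessUnique → FiniteResponseOfUnique → ThermodynamicLimit →
FouriersLaw (decl names of THIS route file; = the type of `closes`). -/
@[route_item "route-AtomisticToContinuum-NoHiddenChargesKubo"]
def Assembly : Prop :=
  GibbsClustering → DrudeWeightExists → ChargeCompleteness → LocalChargeClassification → HydroBridge → GreenKuboOfNoDrude → NessUnique → FiniteResponseOfUnique → ThermodynamicLimit → _root_.FouriersLaw

/-! D-0027 §2.1 — DECIDING THEOREM (planner-authored via `route open/edit --closes-file`; by planner-rrepair-AtomisticToContinuum-NoHiddenC-14021c20-g2-0 2026-08-15T19:38:20Z):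
its hypotheses are this route's items and its conclusion the sub-problem Statement (glue_lint), and it elaborates with this file. -/

/-- D-0027 §2.1 deciding theorem: hypotheses = items of this route, conclusion = the sub-problem
Statement decl `FouriersLaw`. Part (1): the bridge item turns the four mechanism items into
`NoTruncatedDrude`, whose body after `T` is literally the antecedent of the import slot
`GreenKuboOfNoDrude`; part (2) is the Green–Kubo completion exactly as in routes
FourierGreenKubo / CurrentTiltQuench. (Proof re-spelled 2026-08-15 by the cone-repair seat; type unchanged.) -/
@[closes "route-AtomisticToContinuum-NoHiddenChargesKubo"] theorem closes (hC : GibbsClustering) (hP : DrudeWeightExists) (hCC : ChargeCompleteness)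
    (hK : LocalChargeClassification) (hB : HydroBridge) (hGK : GreenKuboOfNoDrude) (hNU : NessUnique)
    (hFR : FiniteResponseOfUnique) (hTL : ThermodynamicLimit) : _root_.FouriersLaw := by
  classical
  have hbridge : NoTruncatedDrude := hB hC hP hCC hK
  intro ω₂ lam β γ hω hl hβ hγ
  have huniq := hNU ω₂ lam β γ hω hl hβ hγ
  constructor
  · intro N T_L T_R hL hR
    rcases Literature.MathematicalPhysics.KineticTheory.HeatConduction.pinnedChain_exists_isSteadyState
        hω hl hβ hγ N hL hR with ⟨μ, hμ⟩
    exact ⟨μ, hμ, fun ν hν => huniq N T_L T_R hL hR ν μ hν hμ⟩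
  · have hW : ∀ T : ℝ, ∀ hT : 0 < T,
        ∃ (μT : MeasureTheory.Measure Literature.MathematicalPhysics.KineticTheory.HeatConduction.ChainConfig)
          (D : Literature.MathematicalPhysics.KineticTheory.HeatConduction.InfiniteChainDynamics
            (Literature.MathematicalPhysics.KineticTheory.HeatConduction.pinnedChain ω₂ lam β γ)),
          (Literature.MathematicalPhysics.KineticTheory.HeatConduction.pinnedChain ω₂ lam β γ).IsChainGibbsMeasure T μT ∧
            D.PreservesMeasure μT ∧ D.HasGreenKubo μT T ∧
            ∀ μ : (N : ℕ) → ℝ → ℝ → MeasureTheory.Measure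
                (Literature.MathematicalPhysics.KineticTheory.HeatConduction.PhaseSpace N),
              (∀ (N : ℕ) (T_L T_R : ℝ), 0 < T_L → 0 < T_R →
                  (Literature.MathematicalPhysics.KineticTheory.HeatConduction.pinnedChain ω₂ lam β γ).IsSteadyState
                    N T_L T_R (μ N T_L T_R)) →
                ∀ Dn : ℕ → ℝ,
                  (∀ N : ℕ, Filter.Tendsto
                    (fun δ : ℝ =>
                      (Literature.MathematicalPhysics.KineticTheory.HeatConduction.pinnedChain ω₂ lam β γ).totalCurrent
                          (μ N (T + δ / 2) (T - δ / 2)) / δ)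
                    (nhdsWithin 0 {(0 : ℝ)}ᶜ) (nhds (Dn N))) →
                    Filter.Tendsto Dn Filter.atTop (nhds (D.greenKuboConductivity μT T)) :=
      fun T hT => hTL ω₂ lam β γ hω hl hβ hγ huniq T hT
        (hGK ω₂ lam β γ hω hl hβ hγ T hT (hbridge ω₂ lam β γ hω hl hβ T hT))
    refine ⟨fun T => if hT : 0 < T then
        (Classical.choose (Classical.choose_spec (hW T hT))).greenKuboConductivity
          (Classical.choose (hW T hT)) T else 1, ?_, ?_⟩
    · intro T hT
      simp only [dif_pos hT]
      exact (Classical.choose_spec (Classical.choose_spec (hW T hT))).2.2.1.pos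
    · intro μ hμ T hT
      have hD := hFR ω₂ lam β γ hω hl hβ hγ huniq μ hμ T hT
      refine ⟨fun N => Classical.choose (hD N), fun N => Classical.choose_spec (hD N), ?_⟩
      simp only [dif_pos hT]
      exact (Classical.choose_spec (Classical.choose_spec (hW T hT))).2.2.2 μ hμ
        (fun N => Classical.choose (hD N)) (fun N => Classical.choose_spec (hD N))

end Summit.AtomisticToContinuum.FouriersLaw.Theses.NoHiddenChargesKubo
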